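import Summits.BirchSwinnertonDyer.BirchSwinnertonDyer.Theorems.EdixhovenFibreFiveSevenLTwistTransferWitnessSurj
import Literature.NumberTheory.EllipticCurves.HeegnerPointsKolyvaginConjugation
import HarnessLib

/-!
# Transfer witness, general irreducible image — PREPARATIONS: `2 × 2` trace algebra over `𝔽_p` and a frame
# adapted to complex conjugation (route `EdixhovenFibreFiveSeven`, crux TDS57, `--supports`; ROAD A′ part 7)

Cell `pub/bsd-wall` (D-0145 line `route-BirchSwinnertonDyer-EdixhovenFibreFiveSeven`), seat `bsd-line-edix-p3`
(prover). THEOREMS ONLY (no definition, no named fact, no `sorry`); route-free. BSD is not proved by this file.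

Toolkit for the finite group theory behind `transferWitness` in the general case `Irr W p`, `p ∈ {5, 7}` (sequel
file): Cayley–Hamilton for `2 × 2` matrices and its trace consequences (`tr(gn) + tr(g n⁻¹) = tr g · tr n` for
`det n = 1`; `(1 + A)^k = 1 + kA` for `A² = 0`; the Fricke-type identity
`3·tr(j z j z⁻¹) = −tr(z)² − tr(zj)² + 6` for `j² = −1`, `det z = 3`), the units of `ℤ/20`, `ℤ/28` as
`⟨2p+3, −1⟩`, and a frame of `E[p]` in which complex conjugation is `diag(1, −1)`.

References: [SilvermanAEC2009] III.7, III.8.1; [Serre1972] §2.6 (images of Galois in `GL₂(𝔽_p)`).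
-/

set_option autoImplicit false
-- the Theorems directory repeats the summit name (sibling precedent `SignedBaseChangeAssembly.lean`)
set_option linter.dupNamespace false

noncomputable section

open scoped Classical MatrixGroups

open WeierstrassCurve NumberField IsDedekindDomain Field Matrix
  Literature.NumberTheory.EllipticCurves Literature.NumberTheory.GaloisRepresentations
  Literature.NumberTheory.EllipticCurves.Rank1Residual
  Literature.NumberTheory.EllipticCurves.DokchitserDokchitser2012

namespace Summit.BirchSwinnertonDyer.BirchSwinnertonDyer.Theorems.LTwistTransfer

/-! ### §1 `2 × 2` algebra -/

section Matrices

variable {R : Type*} [CommRing R]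

/-- Cayley–Hamilton for `2 × 2` matrices: `M² = tr M · M − det M · 1`. [folklore] -/
theorem mul_self_eq_fin_two (M : Matrix (Fin 2) (Fin 2) R) :
    M * M = (M 0 0 + M 1 1) • M - M.det • (1 : Matrix (Fin 2) (Fin 2) R) := by
  ext i j
  rw [Matrix.det_fin_two]
  fin_cases i <;> fin_cases j <;> simp [Matrix.mul_apply, Fin.sum_univ_two] <;> ring

/-- For `det n = 1`: `n · (tr n · 1 − n) = 1` (the adjugate). [folklore] -/
theorem mul_tr_smul_one_sub (n : Matrix (Fin 2) (Fin 2) R) (hdet : n.det = 1) :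
    n * ((n 0 0 + n 1 1) • (1 : Matrix (Fin 2) (Fin 2) R) - n) = 1 := by
  rw [Matrix.mul_sub, Matrix.mul_smul, Matrix.mul_one, mul_self_eq_fin_two, hdet, one_smul]
  abel

/-- `tr(g n) + tr(g (tr n · 1 − n)) = tr n · tr g`. [folklore] -/
theorem trace_mul_add_trace_mul_adj (g n : Matrix (Fin 2) (Fin 2) R) :
    ((g * n) 0 0 + (g * n) 1 1) + ((g * ((n 0 0 + n 1 1) • (1 : Matrix (Fin 2) (Fin 2) R) - n)) 0 0 +
      (g * ((n 0 0 + n 1 1) • (1 : Matrix (Fin 2) (Fin 2) R) - n)) 1 1) =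
      (n 0 0 + n 1 1) * (g 0 0 + g 1 1) := by
  simp [Matrix.mul_apply, Fin.sum_univ_two, Matrix.sub_apply, Matrix.smul_apply]
  ring

/-- `(1 + A)^k = 1 + k·A` when `A² = 0`. [folklore] -/
theorem one_add_pow_of_mul_self_eq_zero (A : Matrix (Fin 2) (Fin 2) R) (hA : A * A = 0) (k : ℕ) :
    (1 + A) ^ k = 1 + (k : R) • A := by
  induction k with
  | zero => simp
  | succ k ih =>
    rw [pow_succ, ih, Matrix.add_mul, Matrix.mul_add, Matrix.mul_add, Matrix.one_mul, Matrix.mul_one,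
      Matrix.one_mul, Matrix.smul_mul, hA, smul_zero, add_zero, Nat.cast_succ, add_smul, one_smul]
    abel

/-- `tr((1 + kA)(1 + B)) = 2 + k·tr(AB)` for trace-zero `A`, `B`. [folklore] -/
theorem trace_one_add_smul_mul_one_add (A B : Matrix (Fin 2) (Fin 2) R) (hA : A 0 0 + A 1 1 = 0)
    (hB : B 0 0 + B 1 1 = 0) (k : R) :
    ((1 + k • A) * (1 + B)) 0 0 + ((1 + k • A) * (1 + B)) 1 1 = 2 + k * ((A * B) 0 0 + (A * B) 1 1) := by
  have hA11 : A 1 1 = -A 0 0 := by linear_combination hA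
  have hB11 : B 1 1 = -B 0 0 := by linear_combination hB
  simp [Matrix.mul_apply, Fin.sum_univ_two, Matrix.add_apply, Matrix.smul_apply, Matrix.one_apply, hA11, hB11]
  ring

/-- A trace-zero matrix `j` with `det j = 1` satisfies `j² = −1`. [folklore] -/
theorem mul_self_eq_neg_one_of_trace_zero (j : Matrix (Fin 2) (Fin 2) R) (htr : j 0 0 + j 1 1 = 0)
    (hdet : j.det = 1) : j * j = -1 := by
  rw [mul_self_eq_fin_two, htr, hdet, zero_smul, one_smul, zero_sub]

/-- **Fricke-type identity.** For `j² = −1` and `z` with `z · w = 1 = w · z`, `det z = d`: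
`d · tr(j z j w) = −tr(z)² − tr(zj)² + 2d`… stated with `3w = tr z · 1 − z` (`det z = 3`):
`tr(j z j (tr z · 1 − z)) = −tr(z)² − tr(zj)² + 6`. [folklore] -/
theorem trace_j_z_j_adj (j z : Matrix (Fin 2) (Fin 2) R) (htr : j 0 0 + j 1 1 = 0) (hdetj : j.det = 1)
    (hdetz : z.det = 3) :
    (j * z * j * ((z 0 0 + z 1 1) • (1 : Matrix (Fin 2) (Fin 2) R) - z)) 0 0 +
      (j * z * j * ((z 0 0 + z 1 1) • (1 : Matrix (Fin 2) (Fin 2) R) - z)) 1 1 =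
      -(z 0 0 + z 1 1) ^ 2 - ((z * j) 0 0 + (z * j) 1 1) ^ 2 + 6 := by
  have hj11 : j 1 1 = -j 0 0 := by linear_combination htr
  rw [Matrix.det_fin_two, hj11] at hdetj
  rw [Matrix.det_fin_two] at hdetz
  simp [Matrix.mul_apply, Fin.sum_univ_two, Matrix.sub_apply, Matrix.smul_apply, hj11]
  linear_combination (-((z 0 0) ^ 2 + (z 1 1) ^ 2 + 2 * z 1 0 * z 0 1)) * hdetj + 2 * hdetz

end Matrices

/-! ### §2 Units of `ℤ/4p` generated by `2p + 3` and `−1` (`p ∈ {5,7}`) -/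

/-- Every unit of `ℤ/20` is `13^a · (−1)^b`, every unit of `ℤ/28` is `17^a · (−1)^b`. [folklore] -/
theorem exists_pow_mul_neg_one_pow {p : ℕ} [Fact p.Prime] (hp57 : p = 5 ∨ p = 7) (u : (ZMod (4 * p))ˣ) :
    ∃ a b : ℕ, (u : ZMod (4 * p)) = ((2 * p + 3 : ℕ) : ZMod (4 * p)) ^ a * (-1) ^ b := by
  rcases hp57 with rfl | rfl
  · have h : ∀ v : (ZMod 20)ˣ, ∃ a : Fin 4, ∃ b : Fin 2,
        (v : ZMod 20) = (13 : ZMod 20) ^ (a : ℕ) * (-1) ^ (b : ℕ) := by decide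
    obtain ⟨a, b, hab⟩ := h u
    exact ⟨a, b, by rw [hab]; norm_num⟩
  · have h : ∀ v : (ZMod 28)ˣ, ∃ a : Fin 6, ∃ b : Fin 2,
        (v : ZMod 28) = (17 : ZMod 28) ^ (a : ℕ) * (-1) ^ (b : ℕ) := by decide
    obtain ⟨a, b, hab⟩ := h u
    exact ⟨a, b, by rw [hab]; norm_num⟩

/-! ### §3 A frame of `E[p]` in which complex conjugation is `diag(1, −1)` -/

/-- `2 v = 0` and `p v = 0` with `p` odd force `v = 0` in `E[p]`. [folklore] -/
theorem eq_zero_of_two_smul_eq_zero (W : WeierstrassCurve ℚ) {p : ℕ} [Fact p.Prime] (hp2 : p ≠ 2)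
    (v : geomTorsion W p) (h2 : v + v = 0) : v = 0 := by
  have hp : p.Prime := Fact.out
  have hodd : Odd p := hp.odd_of_ne_two hp2
  obtain ⟨k, hk⟩ := hodd
  have hpv : (p : ℤ) • (v : geomPoints W) = 0 := (mem_geomTorsion_iff W _ _).mp v.2
  have h2v : (2 : ℤ) • (v : geomPoints W) = 0 := by
    rw [two_zsmul, ← AddMemClass.coe_add, h2, ZeroMemClass.coe_zero]
  apply Subtype.ext
  rw [ZeroMemClass.coe_zero]
  have h1 : ((p : ℤ) - 2 * k) = 1 := by omega
  have : (v : geomPoints W) = ((p : ℤ) - 2 * k) • (v : geomPoints W) := by rw [h1, one_zsmul]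
  rw [this, sub_zsmul, hpv, mul_comm, mul_zsmul, h2v, zsmul_zero]
  simp

/-- **A frame diagonalising complex conjugation.** For `p` odd there is an additive isomorphism
`e : E[p] ≃ 𝔽_p²` in which complex conjugation `c₀` acts as `diag(1, −1)` (its two eigenvectors, tree
`RatClosure.exists_eigenvectors`, form a basis). [cite: McCallumLMS1991, §3 (before Prop. 3.1)] -/
theorem exists_frame_conj_diag (W : WeierstrassCurve ℚ) [W.IsElliptic] (p : ℕ) [Fact p.Prime] (hp2 : p ≠ 2)
    {c₀ : absoluteGaloisGroup ℚ} (hc₀ : IsComplexConjugation (Rat.castHom ℝ) c₀) :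
    ∃ e : geomTorsion W p ≃+ (Fin 2 → ZMod p), rhoMat W e c₀ = !![1, 0; 0, -1] := by
  have hp : p.Prime := Fact.out
  haveI : NeZero p := ⟨hp.ne_zero⟩
  obtain ⟨⟨vP, hvP0, hvP⟩, ⟨vM, hvM0, hvM⟩⟩ :=
    RatClosure.exists_eigenvectors W hc₀ (exists_weilPairing_holds W p) hp2
  obtain ⟨e₀, he₀⟩ := exists_addEquiv_apply_eq_single W p hvP0
  set a : ZMod p := e₀ vM 0 with ha
  set b : ZMod p := e₀ vM 1 with hb
  -- `b ≠ 0`: otherwise `vM` is a multiple of `vP`, fixed and negated by `c₀`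
  have hb0 : b ≠ 0 := by
    intro hb0
    have hvM' : e₀ vM = e₀ ((a.val : ℤ) • vP) := by
      rw [map_zsmul, he₀]
      funext i
      fin_cases i
      · simp [← ha]
      · simp [← hb, hb0]
    have hvMeq : vM = (a.val : ℤ) • vP := e₀.injective hvM'
    have hfix : c₀ • vM = vM := by rw [hvMeq, smul_comm, hvP]
    rw [hfix] at hvM
    exact hvM0 (eq_zero_of_two_smul_eq_zero W hp2 vM (by
      nth_rewrite 2 [hvM]; exact add_neg_cancel vM))
  -- the shear `S = (1 −a/b; 0 1/b)` sends `(1,0) ↦ (1,0)`, `(a,b) ↦ (0,1)`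
  set S : Matrix (Fin 2) (Fin 2) (ZMod p) := !![1, -(a * b⁻¹); 0, b⁻¹] with hS
  have hSdet : S.det * b = 1 := by
    rw [hS, Matrix.det_fin_two_of, mul_zero, sub_zero, one_mul, inv_mul_cancel₀ hb0]
  refine ⟨e₀.trans (mulVecEquiv S b hSdet), ?_⟩
  have he : ∀ T, (e₀.trans (mulVecEquiv S b hSdet)) T = S *ᵥ e₀ T := fun T ↦ rfl
  have heP : (e₀.trans (mulVecEquiv S b hSdet)) vP = Pi.single 0 1 := by
    rw [he, he₀, Matrix.mulVec_single_one, hS]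
    funext i; fin_cases i <;> simp
  have heM : (e₀.trans (mulVecEquiv S b hSdet)) vM = Pi.single 1 1 := by
    rw [he, hS]
    have : e₀ vM = ![a, b] := by funext i; fin_cases i <;> simp [ha, hb]
    rw [this]
    funext i; fin_cases i <;> simp [Matrix.mulVec, dotProduct, Fin.sum_univ_two, hb0]
  -- the matrix of `c₀`
  set N := rhoMat W (e₀.trans (mulVecEquiv S b hSdet)) c₀ with hN
  have hcol0 : N *ᵥ Pi.single 0 1 = Pi.single 0 1 := by
    rw [← heP, ← rhoMat_mulVec, hvP]
  have hcol1 : N *ᵥ Pi.single 1 1 = -Pi.single 1 1 := by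
    rw [← heM, ← rhoMat_mulVec, hvM, map_neg]
  rw [Matrix.mulVec_single_one] at hcol0 hcol1
  ext i j
  fin_cases i <;> fin_cases j
  · simpa using congr_fun hcol0 0
  · simpa using congr_fun hcol1 0
  · simpa using congr_fun hcol0 1
  · simpa using congr_fun hcol1 1

/-! ### §4 Irreducibility in a frame: neither coordinate line is stable -/

/-- **`E[p]` irreducible ⇒ the line `e₁` is not stable**: some `g` has `ρ(g)₁₀ ≠ 0` in the frame `e`.
[cite: Serre1972, §4] -/
theorem exists_apply_one_zero_ne_zero (W : WeierstrassCurve ℚ) [W.IsElliptic] (p : ℕ) [Fact p.Prime]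
    (hirr : W.HasIrreducibleModPGaloisRep p) (e : geomTorsion W p ≃+ (Fin 2 → ZMod p)) :
    ∃ g : absoluteGaloisGroup ℚ, rhoMat W e g 1 0 ≠ 0 := by
  haveI : NeZero p := ⟨(Fact.out : p.Prime).ne_zero⟩
  by_contra h
  push Not at h
  let A : AddSubgroup (geomTorsion W p) :=
    { carrier := {P | e P 1 = 0}
      add_mem' := fun {x y} hx hy ↦ by
        simp only [Set.mem_setOf_eq] at hx hy ⊢
        rw [map_add, Pi.add_apply, hx, hy, add_zero]
      zero_mem' := by simp
      neg_mem' := fun {x} hx ↦ by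
        simp only [Set.mem_setOf_eq] at hx ⊢
        rw [map_neg, Pi.neg_apply, hx, neg_zero] }
  have hAmem : ∀ P, P ∈ A ↔ e P 1 = 0 := fun P ↦ Iff.rfl
  have hstab : ∀ σ : absoluteGaloisGroup ℚ, ∀ P ∈ A, σ • P ∈ A := by
    intro σ P hP
    rw [hAmem] at hP ⊢
    rw [rhoMat_mulVec W e σ P, Matrix.mulVec, dotProduct, Fin.sum_univ_two, h σ, hP, zero_mul,
      mul_zero, add_zero]
  rcases hirr A hstab with hbot | htop
  · have h1 : e.symm (Pi.single 0 1) ∈ A := by rw [hAmem, e.apply_symm_apply]; simp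
    rw [hbot, AddSubgroup.mem_bot] at h1
    have := congrArg e h1
    rw [e.apply_symm_apply, map_zero] at this
    exact one_ne_zero (congr_fun this 0)
  · have h1 : e.symm (Pi.single 1 1) ∈ A := by rw [htop]; exact AddSubgroup.mem_top _
    rw [hAmem, e.apply_symm_apply] at h1
    simp at h1

/-- **`E[p]` irreducible ⇒ the line `e₂` is not stable**: some `g` has `ρ(g)₀₁ ≠ 0` in the frame `e`.
[cite: Serre1972, §4] -/
theorem exists_apply_zero_one_ne_zero (W : WeierstrassCurve ℚ) [W.IsElliptic] (p : ℕ) [Fact p.Prime]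
    (hirr : W.HasIrreducibleModPGaloisRep p) (e : geomTorsion W p ≃+ (Fin 2 → ZMod p)) :
    ∃ g : absoluteGaloisGroup ℚ, rhoMat W e g 0 1 ≠ 0 := by
  haveI : NeZero p := ⟨(Fact.out : p.Prime).ne_zero⟩
  by_contra h
  push Not at h
  let A : AddSubgroup (geomTorsion W p) :=
    { carrier := {P | e P 0 = 0}
      add_mem' := fun {x y} hx hy ↦ by
        simp only [Set.mem_setOf_eq] at hx hy ⊢
        rw [map_add, Pi.add_apply, hx, hy, add_zero]
      zero_mem' := by simp
      neg_mem' := fun {x} hx ↦ by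
        simp only [Set.mem_setOf_eq] at hx ⊢
        rw [map_neg, Pi.neg_apply, hx, neg_zero] }
  have hAmem : ∀ P, P ∈ A ↔ e P 0 = 0 := fun P ↦ Iff.rfl
  have hstab : ∀ σ : absoluteGaloisGroup ℚ, ∀ P ∈ A, σ • P ∈ A := by
    intro σ P hP
    rw [hAmem] at hP ⊢
    rw [rhoMat_mulVec W e σ P, Matrix.mulVec, dotProduct, Fin.sum_univ_two, h σ, hP, zero_mul,
      mul_zero, zero_add]
  rcases hirr A hstab with hbot | htop
  · have h1 : e.symm (Pi.single 1 1) ∈ A := by rw [hAmem, e.apply_symm_apply]; simp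
    rw [hbot, AddSubgroup.mem_bot] at h1
    have := congrArg e h1
    rw [e.apply_symm_apply, map_zero] at this
    exact one_ne_zero (congr_fun this 1)
  · have h1 : e.symm (Pi.single 0 1) ∈ A := by rw [htop]; exact AddSubgroup.mem_top _
    rw [hAmem, e.apply_symm_apply] at h1
    simp at h1

end Summit.BirchSwinnertonDyer.BirchSwinnertonDyer.Theorems.LTwistTransfer

end
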